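import Literature.NumberTheory.Automorphic.ClassNumberConductorStep
import Mathlib.Data.Finset.NatDivisors
import HarnessLib

/-!
# Resummation of the elliptic terms: Eichler–Selberg local densities versus Brandt local embedding numbers

Topic `NumberTheory/Automorphic`; definitions and theorems only (no named fact, no `sorry`).
Fourteenth brick of the Brandt-module side of the Eichler–Pizer trace identity: the purely
arithmetic identity behind the comparison of the elliptic terms of the Eichler–Selberg trace
formula (levels `Mp` and `M`) with the trace of the Brandt matrix `B(n; p, M)`.  For `t² < 4n`,
a prime `p` and a finite set `P ∌ p` of primes,

`Σ_f h_w(Δ/f²) (∏_{q ∈ P} μ_q(f)) (2 - μ_p(f)) = Σ_f h_w(Δ/f²) (∏_{q ∈ P} m_q(f)) m_p(f)`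

(`sum_hw_es_eq_sum_hw_br`), the sums over the conductors `f` of `(t, n)`, where
`μ_q(f) = q + 1` if `q ∣ f` and `ρ_q(t, n)` otherwise (the Eichler–Selberg local density at a
prime level, `esFactor`), `m_q(f) = ρ_q(t_f, n_f) + [fq is a conductor]` (the local embedding
number of `B_f` at a prime `q ∥` level, `brFactor`) and `m_p(f) = 0` if `fp` is a conductor,
`2 - ρ_p(t_f, n_f)` otherwise (the local embedding number at the ramified prime, `brFactorRam`).
The proof swaps one prime at a time (`swap_level`, `swap_ram`): along a `q`-chain
`f₀, f₀q, …, f₀q^a` the weighted class numbers are `h_w(top) · W_e`, `W_0 = 1`,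
`W_e = (q + 1 - ρ_top) q^{e-1}` (`weightedClassNumber_step`), and the two sides are the same
polynomial in `q` (`chain_identity_level`, `chain_identity_ram`).

## References

* M. Eichler, *Zur Zahlentheorie der Quaternionen-Algebren*, J. reine angew. Math. 195 (1955),
  §§6–8 (comparison of the trace formulae), [Eichler1955].
* D. A. Cox, *Primes of the form x² + ny²*, 2nd ed. (2013), Thm. 7.24, [Cox2013].
-/

noncomputable section

open Finset

namespace Literature.NumberTheory.Automorphic

open HeckeTraceFormulaGL2Level

namespace Brandt

variable {t : ℤ} {n : ℕ}

/-! ### The local factors -/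

/-- `h_w((t² - 4n)/f²)`. [cite: SchoofVandervlugt1991, Thm. 2.2 (A₂)] -/
def hw (t : ℤ) (n : ℕ) (f : ℕ) : ℚ := weightedClassNumber ((t ^ 2 - 4 * n) / (f : ℤ) ^ 2)

/-- **The Eichler–Selberg local density at a prime level `q`** (trivial character, `(n, q) = 1`):
`μ_q(t, f, n) = q + 1` if `q ∣ f`, `= ρ_q(t, n)` otherwise. [cite: SchoofVandervlugt1991, Thm. 2.2 (μ(t, f, n))] -/
def esFactor (q : ℕ) (t : ℤ) (n : ℕ) (f : ℕ) : ℚ := if q ∣ f then (q : ℚ) + 1 else rho q t n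

/-- **The local embedding number of `B_f` at a prime `q` exactly dividing the level**:
`m_q(B_f) = ρ_q(t_f, n_f) + [B_f not maximal at q]`. [cite: VignerasLNM800, Ch. II §3; Ch. III §5 Exercice 5.2] -/
def brFactor (q : ℕ) (t : ℤ) (n : ℕ) (f : ℕ) : ℚ :=
  rho q (tOf t n f) (nOf t n f) + if f * q ∈ ellipticConductors t n then 1 else 0

/-- **The local embedding number of `B_f` at the ramified prime `p`**: `0` if `B_f` is not
maximal at `p`, `2 - ρ_p(t_f, n_f) = 1 - (B_f/p)` otherwise. [cite: VignerasLNM800, Ch. II §3; Ch. III §5 Exercice 5.2] -/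
def brFactorRam (p : ℕ) (t : ℤ) (n : ℕ) (f : ℕ) : ℚ :=
  if f * p ∈ ellipticConductors t n then 0 else 2 - rho p (tOf t n f) (nOf t n f)

/-! ### The chain weights and the two polynomial identities -/

/-- The chain weights `W_0 = 1`, `W_e = Y q^{e-1}` (`Y = q + 1 - ρ_top`). [cite: Cox2013, Thm. 7.24] -/
def chainW (q Y : ℚ) (e : ℕ) : ℚ := if e = 0 then 1 else Y * q ^ (e - 1)

/-- `W_{e+1} = Y q^e`. [folklore] -/
theorem chainW_succ (q Y : ℚ) (e : ℕ) : chainW q Y (e + 1) = Y * q ^ e := by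
  simp [chainW]

/-- `W_0 = 1`. [folklore] -/
theorem chainW_zero (q Y : ℚ) : chainW q Y 0 = 1 := by simp [chainW]

/-- **The level identity along a chain**:
`Σ_{e ≤ a} W_e μ(a - e) = Σ_{e ≤ a} W_e m(a - e)` with `μ = q + 1` below the bottom… precisely
`μ(j) = q + 1 (j ≥ 1)`, `μ(0) = 1 (a ≥ 1)`, `μ(0) = X (a = 0)`; `m(j) = 2 (j < a)`, `m(a) = X`. [cite: Eichler1955, §8] -/
theorem chain_identity_level (q X : ℚ) (a : ℕ) :
    ∑ e ∈ range (a + 1), chainW q (q + 1 - X) e * (if e < a then q + 1 else if 1 ≤ a then 1 else X) =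
      ∑ e ∈ range (a + 1), chainW q (q + 1 - X) e * (if 0 < e then 2 else X) := by
  rcases Nat.eq_zero_or_pos a with rfl | ha
  · simp [chainW]
  obtain ⟨m, rfl⟩ : ∃ m, a = m + 1 := ⟨a - 1, by omega⟩
  set Y := q + 1 - X with hY
  have hS := geom_sum_mul q m
  set S := ∑ i ∈ range m, q ^ i with hSdef
  have eL : ∑ e ∈ range (m + 1 + 1), chainW q Y e * (if e < m + 1 then q + 1 else if 1 ≤ m + 1 then 1 else X) =
      (q + 1) * (1 + Y * S) + Y * q ^ m := by
    rw [Finset.sum_range_succ, Finset.sum_range_succ']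
    have h1 : ∑ e ∈ range m, chainW q Y (e + 1) * (if e + 1 < m + 1 then q + 1 else if 1 ≤ m + 1 then 1 else X) =
        (q + 1) * Y * S := by
      rw [hSdef, Finset.mul_sum]
      refine Finset.sum_congr rfl fun e he => ?_
      rw [Finset.mem_range] at he
      rw [chainW_succ, if_pos (by omega)]; ring
    rw [h1, chainW_zero, chainW_succ, if_pos (by omega), if_neg (lt_irrefl _), if_pos (by omega)]
    ring
  have eR : ∑ e ∈ range (m + 1 + 1), chainW q Y e * (if 0 < e then 2 else X) = X + 2 * Y * S + 2 * Y * q ^ m := by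
    rw [Finset.sum_range_succ, Finset.sum_range_succ']
    have h2 : ∑ e ∈ range m, chainW q Y (e + 1) * (if 0 < e + 1 then (2 : ℚ) else X) = 2 * Y * S := by
      rw [hSdef, Finset.mul_sum]
      refine Finset.sum_congr rfl fun e _ => ?_
      rw [chainW_succ, if_pos (Nat.succ_pos e)]; ring
    rw [h2, chainW_zero, chainW_succ, if_pos (Nat.succ_pos m), if_neg (lt_irrefl _)]
    ring
  rw [eL, eR]
  linear_combination Y * hS

/-- **The ramified identity along a chain**:
`Σ_{e ≤ a} W_e (2 - μ_p(a - e)) = W_0 (2 - X)` (`= 1 - (B/p)`). [cite: Eichler1955, §8] -/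
theorem chain_identity_ram (p X : ℚ) (a : ℕ) :
    ∑ e ∈ range (a + 1), chainW p (p + 1 - X) e * (2 - (if e < a then p + 1 else if 1 ≤ a then 1 else X)) =
      ∑ e ∈ range (a + 1), chainW p (p + 1 - X) e * (if 0 < e then 0 else 2 - X) := by
  rcases Nat.eq_zero_or_pos a with rfl | ha
  · simp [chainW]
  obtain ⟨m, rfl⟩ : ∃ m, a = m + 1 := ⟨a - 1, by omega⟩
  set Y := p + 1 - X with hY
  have hS := geom_sum_mul p m
  set S := ∑ i ∈ range m, p ^ i with hSdef
  have eL : ∑ e ∈ range (m + 1 + 1), chainW p Y e * (2 - (if e < m + 1 then p + 1 else if 1 ≤ m + 1 then 1 else X)) =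
      (1 - p) * (1 + Y * S) + Y * p ^ m := by
    rw [Finset.sum_range_succ, Finset.sum_range_succ']
    have h1 : ∑ e ∈ range m, chainW p Y (e + 1) * (2 - (if e + 1 < m + 1 then p + 1 else if 1 ≤ m + 1 then 1 else X)) =
        (1 - p) * Y * S := by
      rw [hSdef, Finset.mul_sum]
      refine Finset.sum_congr rfl fun e he => ?_
      rw [Finset.mem_range] at he
      rw [chainW_succ, if_pos (by omega)]; ring
    rw [h1, chainW_zero, chainW_succ, if_pos (by omega), if_neg (lt_irrefl _), if_pos (by omega)]
    ring
  have eR : ∑ e ∈ range (m + 1 + 1), chainW p Y e * (if 0 < e then 0 else 2 - X) = 2 - X := by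
    rw [Finset.sum_range_succ, Finset.sum_range_succ']
    have h2 : ∑ e ∈ range m, chainW p Y (e + 1) * (if 0 < e + 1 then (0 : ℚ) else 2 - X) = 0 := by
      refine Finset.sum_eq_zero fun e _ => ?_
      rw [if_pos (Nat.succ_pos e), mul_zero]
    rw [h2, chainW_zero, if_pos (Nat.succ_pos m), if_neg (lt_irrefl _)]
    ring
  rw [eL, eR]
  linear_combination (-Y) * hS

/-! ### Divisors of `F₀ q^a` -/

/-- **Sums over the divisors of `F₀ q^a`, `q ∤ F₀`, as double sums over chains.** [folklore] -/
theorem sum_divisors_mul_prime_pow {F₀ q a : ℕ} (hq : q.Prime) (hF₀ : ¬ q ∣ F₀) (G : ℕ → ℚ) :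
    ∑ f ∈ (F₀ * q ^ a).divisors, G f = ∑ f₀ ∈ F₀.divisors, ∑ j ∈ range (a + 1), G (f₀ * q ^ j) := by
  classical
  have hcop : F₀.Coprime (q ^ a) :=
    Nat.Coprime.pow_right a ((Nat.Prime.coprime_iff_not_dvd hq).mpr hF₀).symm
  rw [Nat.divisors_mul, Finset.mul_def,
    Finset.sum_image (fun x hx y hy hxy => hcop.mul_injOn_divisors hx hy hxy), Finset.sum_product]
  refine Finset.sum_congr rfl fun f₀ _ => ?_
  rw [Nat.divisors_prime_pow hq a, Finset.sum_map]
  rfl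

/-! ### Chains of conductors -/

/-- **A `q`-chain of conductors**: `F = F₀ q^a` with `q ∤ F₀`, and `f₀ ∣ F₀`. [cite: Cox2013, §7.A (conductors)] -/
structure Chain (t : ℤ) (n : ℕ) (q F₀ a f₀ : ℕ) : Prop where
  hlt : t ^ 2 < 4 * n
  hq : q.Prime
  hF : conductor t n = F₀ * q ^ a
  hqF₀ : ¬ q ∣ F₀
  hf₀ : f₀ ∣ F₀

/-- The chain decomposition of the conductor along `q`. [folklore] -/
theorem conductor_eq_ordCompl_mul (h : t ^ 2 < 4 * n) {q : ℕ} (hq : q.Prime) :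
    conductor t n = (conductor t n / q ^ (conductor t n).factorization q) * q ^ (conductor t n).factorization q ∧
      ¬ q ∣ conductor t n / q ^ (conductor t n).factorization q := by
  refine ⟨?_, Nat.not_dvd_ordCompl hq (conductor_pos h).ne'⟩
  rw [mul_comm]
  exact (Nat.ordProj_mul_ordCompl_eq_self (conductor t n) q).symm

namespace Chain

variable {q F₀ a f₀ : ℕ} (C : Chain t n q F₀ a f₀)
include C

/-- `F₀ ≠ 0`. [folklore] -/
theorem F₀_ne_zero : F₀ ≠ 0 := by
  intro h0
  have := conductor_pos C.hlt
  rw [C.hF, h0, zero_mul] at this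
  exact lt_irrefl 0 this

/-- `f₀ ≠ 0` and `q ∤ f₀`. [folklore] -/
theorem f₀_ne_zero : f₀ ≠ 0 := fun h0 => C.F₀_ne_zero (Nat.eq_zero_of_zero_dvd (h0 ▸ C.hf₀))

/-- `q ∤ f₀`. [folklore] -/
theorem not_dvd_f₀ : ¬ q ∣ f₀ := fun h => C.hqF₀ (h.trans C.hf₀)

/-- **`f₀ q^j` is a conductor for `j ≤ a`.** [folklore] -/
theorem mem (j : ℕ) (hj : j ≤ a) : f₀ * q ^ j ∈ ellipticConductors t n := by
  rw [mem_ellipticConductors_iff_dvd C.hlt, C.hF]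
  exact mul_dvd_mul C.hf₀ (pow_dvd_pow q hj)

/-- **`f₀ q^j · q` is a conductor iff `j < a`.** [folklore] -/
theorem mul_mem_iff {j : ℕ} (hj : j ≤ a) : f₀ * q ^ j * q ∈ ellipticConductors t n ↔ j < a := by
  constructor
  · intro h
    by_contra hja
    have hja' : j = a := le_antisymm hj (not_lt.mp hja)
    subst hja'
    rw [mem_ellipticConductors_iff_dvd C.hlt, C.hF] at h
    have h0 : q ^ (j + 1) ∣ f₀ * q ^ j * q := Dvd.intro f₀ (by ring)
    have h1 : q ^ (j + 1) ∣ F₀ * q ^ j := h0.trans h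
    rw [pow_succ, mul_comm F₀] at h1
    have h2 : q ∣ F₀ := (mul_dvd_mul_iff_left (pow_ne_zero j C.hq.ne_zero)).mp h1
    exact C.hqF₀ h2
  · intro h
    rw [mul_assoc, ← pow_succ]
    exact C.mem (j + 1) h

/-- **`ρ_q` along the chain**: `1` below the top, `X = ρ_q(t_top, n_top)` at the top. [cite: Cox2013, §7.D Prop. 7.20] -/
theorem rho_eq (j : ℕ) (hj : j ≤ a) :
    rho q (tOf t n (f₀ * q ^ j)) (nOf t n (f₀ * q ^ j)) =
      if j < a then 1 else rho q (tOf t n (f₀ * q ^ a)) (nOf t n (f₀ * q ^ a)) := by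
  split_ifs with hja
  · exact rho_tOf_eq_one C.hlt C.hq ((C.mul_mem_iff hj).mpr hja)
  · have : j = a := by omega
    subst this; rfl

/-- **`ρ_q(t, n)` in terms of the chain**: `1` if `a ≥ 1`, `X` if `a = 0`. [cite: Cox2013, §7.D Prop. 7.20] -/
theorem rho_base : (rho q t n : ℚ) =
    if 1 ≤ a then (1 : ℚ) else (rho q (tOf t n (f₀ * q ^ a)) (nOf t n (f₀ * q ^ a)) : ℚ) := by
  have h0 : rho q t n = rho q (tOf t n (f₀ * q ^ 0)) (nOf t n (f₀ * q ^ 0)) := by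
    rw [pow_zero, mul_one]
    exact (rho_tOf_eq C.hlt C.hq (by have := C.mem 0 (Nat.zero_le a); rwa [pow_zero, mul_one] at this) C.not_dvd_f₀).symm
  rw [h0, C.rho_eq 0 (Nat.zero_le a)]
  by_cases ha : 1 ≤ a
  · simp [ha, show 0 < a by omega]
  · simp [ha, show ¬ (0 < a) by omega]

/-- **The weighted class numbers along the chain**: `h_w(f₀ q^j) = h_w(f₀ q^a) · W_{a-j}`. [cite: Cox2013, Thm. 7.24] -/
theorem hw_eq (j : ℕ) (hj : j ≤ a) :
    hw t n (f₀ * q ^ j) = hw t n (f₀ * q ^ a) *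
      chainW q (q + 1 - rho q (tOf t n (f₀ * q ^ a)) (nOf t n (f₀ * q ^ a))) (a - j) := by
  -- downward induction on `e = a - j`
  suffices key : ∀ e : ℕ, e ≤ a → hw t n (f₀ * q ^ (a - e)) = hw t n (f₀ * q ^ a) *
      chainW q (q + 1 - rho q (tOf t n (f₀ * q ^ a)) (nOf t n (f₀ * q ^ a))) e by
    have := key (a - j) (Nat.sub_le a j)
    rwa [Nat.sub_sub_self hj] at this
  intro e he
  induction e with
  | zero => rw [Nat.sub_zero, chainW_zero, mul_one]
  | succ e ih =>
    have ih' := ih (by omega)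
    -- the step `f₀ q^{a-e-1} ↦ f₀ q^{a-e}`
    have hstep := weightedClassNumber_step C.hlt (f := f₀ * q ^ (a - (e + 1))) C.hq (by
      rw [mul_assoc, ← pow_succ, show a - (e + 1) + 1 = a - e by omega]; exact C.mem _ (Nat.sub_le a e))
    have e1 : f₀ * q ^ (a - (e + 1)) * q = f₀ * q ^ (a - e) := by
      rw [mul_assoc, ← pow_succ, show a - (e + 1) + 1 = a - e by omega]
    rw [e1] at hstep
    unfold hw at ih' ⊢
    push_cast at hstep ih' ⊢
    rw [hstep, ih', C.rho_eq (a - e) (Nat.sub_le a e), chainW_succ]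
    unfold chainW
    by_cases he0 : e = 0
    · subst he0; simp
    · rw [if_neg he0, if_pos (by omega)]
      obtain ⟨e', rfl⟩ : ∃ e', e = e' + 1 := ⟨e - 1, by omega⟩
      rw [Nat.add_sub_cancel, pow_succ]; push_cast; ring

/-- **The Eichler–Selberg factor along the chain.** [cite: SchoofVandervlugt1991, Thm. 2.2 (μ(t, f, n))] -/
theorem esFactor_eq (j : ℕ) :
    esFactor q t n (f₀ * q ^ j) =
      if j < 0 + 1 then (if 1 ≤ a then 1 else (rho q (tOf t n (f₀ * q ^ a)) (nOf t n (f₀ * q ^ a)) : ℚ)) else (q : ℚ) + 1 := by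
  unfold esFactor
  by_cases hj : 1 ≤ j
  · rw [if_pos (Dvd.dvd.mul_left (dvd_pow_self q (by omega)) _), if_neg (by omega)]
  · have hj0 : j = 0 := by omega
    subst hj0
    rw [pow_zero, mul_one, if_neg C.not_dvd_f₀, if_pos (by omega), C.rho_base]

/-- **The Brandt level factor along the chain.** [cite: VignerasLNM800, Ch. III §5 Exercice 5.2] -/
theorem brFactor_eq (j : ℕ) (hj : j ≤ a) :
    brFactor q t n (f₀ * q ^ j) = if j < a then 2 else (rho q (tOf t n (f₀ * q ^ a)) (nOf t n (f₀ * q ^ a)) : ℚ) := by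
  unfold brFactor
  rw [C.rho_eq j hj]
  by_cases hja : j < a
  · rw [if_pos hja, if_pos ((C.mul_mem_iff hj).mpr hja), if_pos hja]; norm_num
  · rw [if_neg hja, if_neg (fun h => hja ((C.mul_mem_iff hj).mp h)), if_neg hja, add_zero]

/-- **The Brandt ramified factor along the chain.** [cite: VignerasLNM800, Ch. III §5 Exercice 5.2] -/
theorem brFactorRam_eq (j : ℕ) (hj : j ≤ a) :
    brFactorRam q t n (f₀ * q ^ j) = if j < a then 0 else 2 - (rho q (tOf t n (f₀ * q ^ a)) (nOf t n (f₀ * q ^ a)) : ℚ) := by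
  unfold brFactorRam
  by_cases hja : j < a
  · rw [if_pos ((C.mul_mem_iff hj).mpr hja), if_pos hja]
  · rw [if_neg (fun h => hja ((C.mul_mem_iff hj).mp h)), if_neg hja, C.rho_eq j hj, if_neg hja]

/-- An invariant weight is constant along the chain. [folklore] -/
theorem weight_eq {A : ℕ → ℚ} (hA : ∀ f, f * q ∈ ellipticConductors t n → A (f * q) = A f) (j : ℕ) (hj : j ≤ a) :
    A (f₀ * q ^ j) = A f₀ := by
  induction j with
  | zero => rw [pow_zero, mul_one]
  | succ j ih =>
    rw [pow_succ, ← mul_assoc, hA _ ((C.mul_mem_iff (by omega)).mpr (by omega))]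
    exact ih (by omega)

end Chain

/-! ### Swapping one prime -/

/-- **Swapping the factor at a level prime `q`.** [cite: Eichler1955, §8; Cox2013, Thm. 7.24] -/
theorem swap_level (h : t ^ 2 < 4 * n) {q : ℕ} (hq : q.Prime) {A : ℕ → ℚ}
    (hA : ∀ f, f * q ∈ ellipticConductors t n → A (f * q) = A f) :
    ∑ f ∈ ellipticConductors t n, hw t n f * A f * esFactor q t n f =
      ∑ f ∈ ellipticConductors t n, hw t n f * A f * brFactor q t n f := by
  obtain ⟨hF, hqF₀⟩ := conductor_eq_ordCompl_mul h hq
  set a := (conductor t n).factorization q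
  set F₀ := conductor t n / q ^ a
  rw [ellipticConductors_eq_divisors h, hF, sum_divisors_mul_prime_pow hq hqF₀, sum_divisors_mul_prime_pow hq hqF₀]
  refine Finset.sum_congr rfl fun f₀ hf₀ => ?_
  have C : Chain t n q F₀ a f₀ := ⟨h, hq, hF, hqF₀, (Nat.mem_divisors.mp hf₀).1⟩
  set X : ℚ := (rho q (tOf t n (f₀ * q ^ a)) (nOf t n (f₀ * q ^ a)) : ℚ)
  have hL : ∀ j ∈ range (a + 1), hw t n (f₀ * q ^ j) * A (f₀ * q ^ j) * esFactor q t n (f₀ * q ^ j) =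
      hw t n (f₀ * q ^ a) * A f₀ * (chainW q (q + 1 - X) (a - j) *
        (if a - j < a then (q : ℚ) + 1 else if 1 ≤ a then 1 else X)) := by
    intro j hj
    rw [Finset.mem_range] at hj
    rw [C.hw_eq j (by omega), C.weight_eq hA j (by omega), C.esFactor_eq j]
    have e : (j < 0 + 1) = ¬ (a - j < a) := by apply propext; omega
    simp only [e, ite_not]
    ring
  have hR : ∀ j ∈ range (a + 1), hw t n (f₀ * q ^ j) * A (f₀ * q ^ j) * brFactor q t n (f₀ * q ^ j) =
      hw t n (f₀ * q ^ a) * A f₀ * (chainW q (q + 1 - X) (a - j) * (if 0 < a - j then 2 else X)) := by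
    intro j hj
    rw [Finset.mem_range] at hj
    rw [C.hw_eq j (by omega), C.weight_eq hA j (by omega), C.brFactor_eq j (by omega)]
    have e : (j < a) = (0 < a - j) := by apply propext; omega
    simp only [e]
    ring
  rw [Finset.sum_congr rfl hL, Finset.sum_congr rfl hR, ← Finset.mul_sum, ← Finset.mul_sum]
  congr 1
  have e1 := Finset.sum_range_reflect (fun e => chainW q (q + 1 - X) e *
    (if e < a then (q : ℚ) + 1 else if 1 ≤ a then 1 else X)) (a + 1)
  have e2 := Finset.sum_range_reflect (fun e => chainW q (q + 1 - X) e * (if 0 < e then 2 else X)) (a + 1)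
  simp only [Nat.add_sub_cancel] at e1 e2
  rw [e1, e2]
  exact chain_identity_level q X a

/-- **Swapping the factor at the ramified prime `p`.** [cite: Eichler1955, §8; Cox2013, Thm. 7.24] -/
theorem swap_ram (h : t ^ 2 < 4 * n) {p : ℕ} (hp : p.Prime) {A : ℕ → ℚ}
    (hA : ∀ f, f * p ∈ ellipticConductors t n → A (f * p) = A f) :
    ∑ f ∈ ellipticConductors t n, hw t n f * A f * (2 - esFactor p t n f) =
      ∑ f ∈ ellipticConductors t n, hw t n f * A f * brFactorRam p t n f := by
  obtain ⟨hF, hqF₀⟩ := conductor_eq_ordCompl_mul h hp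
  set a := (conductor t n).factorization p
  set F₀ := conductor t n / p ^ a
  rw [ellipticConductors_eq_divisors h, hF, sum_divisors_mul_prime_pow hp hqF₀, sum_divisors_mul_prime_pow hp hqF₀]
  refine Finset.sum_congr rfl fun f₀ hf₀ => ?_
  have C : Chain t n p F₀ a f₀ := ⟨h, hp, hF, hqF₀, (Nat.mem_divisors.mp hf₀).1⟩
  set X : ℚ := (rho p (tOf t n (f₀ * p ^ a)) (nOf t n (f₀ * p ^ a)) : ℚ)
  have hL : ∀ j ∈ range (a + 1), hw t n (f₀ * p ^ j) * A (f₀ * p ^ j) * (2 - esFactor p t n (f₀ * p ^ j)) =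
      hw t n (f₀ * p ^ a) * A f₀ * (chainW p (p + 1 - X) (a - j) *
        (2 - (if a - j < a then (p : ℚ) + 1 else if 1 ≤ a then 1 else X))) := by
    intro j hj
    rw [Finset.mem_range] at hj
    rw [C.hw_eq j (by omega), C.weight_eq hA j (by omega), C.esFactor_eq j]
    have e : (j < 0 + 1) = ¬ (a - j < a) := by apply propext; omega
    simp only [e, ite_not]
    ring
  have hR : ∀ j ∈ range (a + 1), hw t n (f₀ * p ^ j) * A (f₀ * p ^ j) * brFactorRam p t n (f₀ * p ^ j) =
      hw t n (f₀ * p ^ a) * A f₀ * (chainW p (p + 1 - X) (a - j) * (if 0 < a - j then 0 else 2 - X)) := by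
    intro j hj
    rw [Finset.mem_range] at hj
    rw [C.hw_eq j (by omega), C.weight_eq hA j (by omega), C.brFactorRam_eq j (by omega)]
    have e : (j < a) = (0 < a - j) := by apply propext; omega
    simp only [e]
    ring
  rw [Finset.sum_congr rfl hL, Finset.sum_congr rfl hR, ← Finset.mul_sum, ← Finset.mul_sum]
  congr 1
  have e1 := Finset.sum_range_reflect (fun e => chainW p (p + 1 - X) e *
    (2 - (if e < a then (p : ℚ) + 1 else if 1 ≤ a then 1 else X))) (a + 1)
  have e2 := Finset.sum_range_reflect (fun e => chainW p (p + 1 - X) e * (if 0 < e then 0 else 2 - X)) (a + 1)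
  simp only [Nat.add_sub_cancel] at e1 e2
  rw [e1, e2]
  exact chain_identity_ram p X a

/-! ### The resummation -/

/-- The Brandt level factor is invariant under steps at other primes. [folklore] -/
theorem brFactor_mul (h : t ^ 2 < 4 * n) {q q' : ℕ} (hq : q.Prime) (hq' : q'.Prime) (hqq' : q ≠ q') {f : ℕ}
    (hfq' : f * q' ∈ ellipticConductors t n) : brFactor q t n (f * q') = brFactor q t n f := by
  have hf : f ∈ ellipticConductors t n := dvd_mem_ellipticConductors h hfq' (dvd_mul_right f q')
  have hf0 := (pos_of_mem_ellipticConductors h hf).ne'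
  unfold brFactor
  congr 1
  · rw [rho_tOf_eq_of_dvd h hq hfq' (dvd_mul_right f q') (by
      rw [Nat.mul_div_cancel_left _ (Nat.pos_of_ne_zero hf0)]
      intro hd; exact hqq' ((Nat.prime_dvd_prime_iff_eq hq hq').mp hd))]
  · -- `f q' q` conductor iff `f q` conductor
    have key : f * q' * q ∈ ellipticConductors t n ↔ f * q ∈ ellipticConductors t n := by
      constructor
      · intro hm; exact dvd_mem_ellipticConductors h hm ⟨q', by ring⟩
      · intro hm
        have := lcm_mem_ellipticConductors h hm hfq'
        have e : (f * q).lcm (f * q') = f * q' * q := by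
          rw [Nat.lcm_mul_left, ((Nat.coprime_primes hq hq').mpr hqq').lcm_eq_mul]; ring
        rwa [e] at this
    simp only [key]

/-- The ramified factor is invariant under steps at other primes. [folklore] -/
theorem brFactorRam_mul (h : t ^ 2 < 4 * n) {p q' : ℕ} (hp : p.Prime) (hq' : q'.Prime) (hpq' : p ≠ q') {f : ℕ}
    (hfq' : f * q' ∈ ellipticConductors t n) : brFactorRam p t n (f * q') = brFactorRam p t n f := by
  have hf : f ∈ ellipticConductors t n := dvd_mem_ellipticConductors h hfq' (dvd_mul_right f q')
  have hf0 := (pos_of_mem_ellipticConductors h hf).ne'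
  unfold brFactorRam
  have key : f * q' * p ∈ ellipticConductors t n ↔ f * p ∈ ellipticConductors t n := by
    constructor
    · intro hm; exact dvd_mem_ellipticConductors h hm ⟨q', by ring⟩
    · intro hm
      have := lcm_mem_ellipticConductors h hm hfq'
      have e : (f * p).lcm (f * q') = f * q' * p := by
        rw [Nat.lcm_mul_left, ((Nat.coprime_primes hp hq').mpr hpq').lcm_eq_mul]; ring
      rwa [e] at this
  rw [rho_tOf_eq_of_dvd h hp hfq' (dvd_mul_right f q') (by
      rw [Nat.mul_div_cancel_left _ (Nat.pos_of_ne_zero hf0)]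
      intro hd; exact hpq' ((Nat.prime_dvd_prime_iff_eq hp hq').mp hd))]
  simp only [key]

/-- The Eichler–Selberg factor is invariant under steps at other primes. [folklore] -/
theorem esFactor_mul {q q' : ℕ} (hq : q.Prime) (hq' : q'.Prime) (hqq' : q ≠ q') (f : ℕ) :
    esFactor q t n (f * q') = esFactor q t n f := by
  unfold esFactor
  have key : q ∣ f * q' ↔ q ∣ f := by
    constructor
    · intro hd
      rcases (Nat.Prime.dvd_mul hq).mp hd with h1 | h1
      · exact h1
      · exact absurd ((Nat.prime_dvd_prime_iff_eq hq hq').mp h1) hqq'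
    · intro hd; exact hd.mul_right _
  simp only [key]

/-- **The resummation identity** (the arithmetic heart of the comparison of the elliptic terms):
for `t² < 4n`, a prime `p` and a finite set of primes `P ∌ p`,
`Σ_f h_w(Δ/f²) (∏_{q∈P} μ_q(f)) (2 - μ_p(f)) = Σ_f h_w(Δ/f²) (∏_{q∈P} m_q(f)) m_p(f)`. [cite: Eichler1955, §8; Cox2013, Thm. 7.24] -/
theorem sum_hw_es_eq_sum_hw_br (h : t ^ 2 < 4 * n) {p : ℕ} (hp : p.Prime) (P : Finset ℕ)
    (hP : ∀ q ∈ P, q.Prime) (hpP : p ∉ P) :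
    ∑ f ∈ ellipticConductors t n, hw t n f * ((∏ q ∈ P, esFactor q t n f) * (2 - esFactor p t n f)) =
      ∑ f ∈ ellipticConductors t n, hw t n f * ((∏ q ∈ P, brFactor q t n f) * brFactorRam p t n f) := by
  classical
  -- first swap the ramified prime, then the level primes one at a time
  have step0 : ∑ f ∈ ellipticConductors t n, hw t n f * ((∏ q ∈ P, esFactor q t n f) * (2 - esFactor p t n f)) =
      ∑ f ∈ ellipticConductors t n, hw t n f * ((∏ q ∈ P, esFactor q t n f) * brFactorRam p t n f) := by
    have := swap_ram h hp (A := fun f => ∏ q ∈ P, esFactor q t n f) (fun f _ => by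
      refine Finset.prod_congr rfl fun q hq => esFactor_mul (hP q hq) hp (ne_of_mem_of_not_mem hq hpP) f)
    simp only [mul_assoc] at this ⊢
    exact this
  rw [step0]
  -- induction on `P`: swap the primes of `s ⊆ P`
  suffices key : ∀ s : Finset ℕ, s ⊆ P →
      ∑ f ∈ ellipticConductors t n, hw t n f * ((∏ q ∈ P, esFactor q t n f) * brFactorRam p t n f) =
        ∑ f ∈ ellipticConductors t n, hw t n f *
          (((∏ q ∈ s, brFactor q t n f) * ∏ q ∈ P \ s, esFactor q t n f) * brFactorRam p t n f) by
    have := key P subset_rfl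
    simpa only [Finset.sdiff_self, Finset.prod_empty, mul_one] using this
  intro s
  induction s using Finset.induction_on with
  | empty => intro _; simp
  | insert q₀ s hq₀s ih =>
    intro hs
    have hq₀P : q₀ ∈ P := hs (Finset.mem_insert_self _ _)
    have hq₀ : q₀.Prime := hP q₀ hq₀P
    rw [ih (fun x hx => hs (Finset.mem_insert_of_mem hx))]
    -- isolate the factor `esFactor q₀` in `∏_{P \ s}` and swap it
    have hsd : P \ s = insert q₀ (P \ insert q₀ s) := by
      ext x
      simp only [Finset.mem_sdiff, Finset.mem_insert]
      constructor
      · rintro ⟨hxP, hxs⟩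
        by_cases hx : x = q₀
        · exact Or.inl hx
        · exact Or.inr ⟨hxP, fun h' => h'.elim hx hxs⟩
      · rintro (rfl | ⟨hxP, hx⟩)
        · exact ⟨hq₀P, hq₀s⟩
        · exact ⟨hxP, fun h' => hx (Or.inr h')⟩
    have hq₀nd : q₀ ∉ P \ insert q₀ s := by simp
    let A : ℕ → ℚ := fun f => (∏ q ∈ s, brFactor q t n f) * (∏ q ∈ P \ insert q₀ s, esFactor q t n f) * brFactorRam p t n f
    have hA : ∀ f, f * q₀ ∈ ellipticConductors t n → A (f * q₀) = A f := by
      intro f hf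
      simp only [A]
      rw [brFactorRam_mul h hp hq₀ (ne_of_mem_of_not_mem hq₀P hpP).symm hf,
        Finset.prod_congr rfl fun q hq => brFactor_mul h (hP q (hs (Finset.mem_insert_of_mem hq))) hq₀
          (ne_of_mem_of_not_mem hq hq₀s) hf,
        Finset.prod_congr rfl fun q hq => esFactor_mul (hP q (Finset.mem_sdiff.mp hq).1) hq₀
          (ne_of_mem_of_not_mem hq hq₀nd) f]
    have hswap := swap_level h hq₀ hA
    have eL : ∀ f, hw t n f * (((∏ q ∈ s, brFactor q t n f) * ∏ q ∈ P \ s, esFactor q t n f) * brFactorRam p t n f) =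
        hw t n f * A f * esFactor q₀ t n f := by
      intro f; simp only [A]; rw [hsd, Finset.prod_insert hq₀nd]; ring
    have eR : ∀ f, hw t n f * (((∏ q ∈ insert q₀ s, brFactor q t n f) * ∏ q ∈ P \ insert q₀ s, esFactor q t n f) *
        brFactorRam p t n f) = hw t n f * A f * brFactor q₀ t n f := by
      intro f; simp only [A]; rw [Finset.prod_insert hq₀s]; ring
    simp only [eL, eR]
    exact hswap

end Brandt

end Literature.NumberTheory.Automorphic

end
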